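import Mathlib
import Literature.Computability.AlgebraicComplexity.PermanentIrreducible
import Summits.ValiantsHypothesis.ValiantsHypothesis.Theses.ForgivenCollisions

/-!
# ValiantsHypothesis / ForgivenCollisions — `PurePowerAnchor`

Route `ForgivenCollisions`, item `stmt-ValiantsHypothesis-11572` (support, rank 9): the anchor of
the collision ladder.  Modulo the first collision ideal `J_1(n)` — the monomial ideal spanned by
the exponents with a tripled line or at least one doubled row or column — the permanent is a pure
`n`-th power:
`(Σ_{ij} x_{ij})^n − n! · per_n ∈ J_1(n)`.

Proof.  By `MvPolynomial.mem_ideal_span_monomial_image` it suffices that every exponent `d` in the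
support of the difference is bad; contrapositively, if all row and column counts of `d` are `≤ 1`
("rook-legal") the two coefficients agree.  By the multinomial theorem
(`Finset.sum_pow_eq_sum_piAntidiag`) the coefficient of `x^d` in `(Σ x)^n` is the multinomial
coefficient of `d` when `|d| = n` and `0` otherwise (`coeff_sum_X_pow`); a rook-legal `d` of
degree `n` is a permutation monomial (`exists_permMonomial_eq_of_counts_le_one`), where the
multinomial coefficient is `n!` (`multinomial_permMonomial`) and the coefficient of `per_n` is `1`;
every other rook-legal `d` has coefficient `0` in both (the permanent is supported on permutation
monomials, `exists_permMonomial_eq_of_coeff_perPoly_ne_zero`).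
-/

set_option linter.dupNamespace false -- single-conjunct summit: `ValiantsHypothesis.ValiantsHypothesis`

namespace Summit.ValiantsHypothesis.ValiantsHypothesis.Theorems.ForgivenCollisions

open MvPolynomial Finset Literature.Computability.AlgebraicComplexity

/-! ### The coefficients of `(Σ_v X_v)^n` -/

/-- Multinomial theorem, coefficient form: the coefficient of `x^d` in `(Σ_v x_v) ^ n` (sum over
all variables of a finite type) is the multinomial coefficient `n! / Π_v d(v)!` if `|d| = n`, and
`0` otherwise. [folklore] -/
theorem coeff_sum_X_pow {V : Type*} [Fintype V] [DecidableEq V] (R : Type*) [CommSemiring R]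
    (n : ℕ) (d : V →₀ ℕ) :
    coeff d ((∑ v : V, (X v : MvPolynomial V R)) ^ n) =
      if ∑ v, d v = n then (Nat.multinomial Finset.univ d : R) else 0 := by
  have hmon : ∀ k : V → ℕ, (∏ v : V, (X v : MvPolynomial V R) ^ k v) =
      monomial (Finsupp.equivFunOnFinite.symm k) 1 := fun k => by
    rw [Finsupp.equivFunOnFinite_symm_eq_sum, monomial_sum_one]
    exact Finset.prod_congr rfl fun v _ => X_pow_eq_monomial
  have hterm : ∀ k : V → ℕ, coeff d ((Nat.multinomial univ k : MvPolynomial V R) *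
      ∏ v : V, (X v : MvPolynomial V R) ^ k v) =
      if k = ⇑d then (Nat.multinomial Finset.univ k : R) else 0 := fun k => by
    rw [hmon, ← nsmul_eq_mul, coeff_smul, coeff_monomial]
    by_cases hk : k = ⇑d
    · rw [if_pos hk, if_pos (by rw [hk]; exact Finsupp.equivFunOnFinite_symm_coe d), nsmul_eq_mul,
        mul_one]
    · rw [if_neg hk, if_neg (fun h => hk (by rw [← h]; rfl)), smul_zero]
  rw [Finset.sum_pow_eq_sum_piAntidiag, coeff_sum]
  simp_rw [hterm]
  rw [Finset.sum_ite_eq']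
  simp only [mem_piAntidiag, mem_univ, imp_true_iff, and_true]

/-! ### Rook-legal exponents of full degree are permutation monomials -/

/-- The degree of a permutation monomial, as a plain sum: `Σ_v μ_σ(v) = n`. [folklore] -/
theorem sum_permMonomial {n : ℕ} (σ : Equiv.Perm (Fin n)) :
    ∑ v : Fin n × Fin n, permMonomial σ v = n := by
  calc ∑ v : Fin n × Fin n, permMonomial σ v = ∑ c, colCount (permMonomial σ) c := by
        unfold colCount
        rw [Fintype.sum_prod_type, Finset.sum_comm]
    _ = n := by simp [colCount_permMonomial]

/-- The multinomial coefficient of a permutation monomial is `n!` (all its exponents are `≤ 1`).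
[folklore] -/
theorem multinomial_permMonomial {n : ℕ} (σ : Equiv.Perm (Fin n)) :
    Nat.multinomial Finset.univ (permMonomial σ) = n.factorial := by
  have hprod : ∏ v : Fin n × Fin n, (permMonomial σ v).factorial = 1 := by
    refine Finset.prod_eq_one fun v _ => ?_
    obtain ⟨r, c⟩ := v
    rw [permMonomial_apply]
    split_ifs <;> rfl
  have h := Nat.multinomial_spec (Finset.univ : Finset (Fin n × Fin n)) (permMonomial σ)
  rwa [hprod, one_mul, sum_permMonomial] at h

/-- An exponent vector on the `n × n` variables all of whose row and column counts are `≤ 1` and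
whose degree is `n` is a permutation monomial `μ_σ`. [folklore] -/
theorem exists_permMonomial_eq_of_counts_le_one {n : ℕ} (d : Fin n × Fin n →₀ ℕ)
    (hrow : ∀ i, rowCount d i ≤ 1) (hcol : ∀ j, colCount d j ≤ 1) (hdeg : ∑ v, d v = n) :
    ∃ σ : Equiv.Perm (Fin n), permMonomial σ = d := by
  -- every column count is exactly one
  have hsum : ∑ j, colCount d j = ∑ v, d v := by
    unfold colCount
    rw [Fintype.sum_prod_type]
    exact Finset.sum_comm
  have hcol1 : ∀ j, colCount d j = 1 := by
    by_contra h
    push Not at h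
    obtain ⟨j, hj⟩ := h
    have hlt : colCount d j < 1 := lt_of_le_of_ne (hcol j) hj
    have h' : ∑ j, colCount d j < ∑ _j : Fin n, (1 : ℕ) :=
      Finset.sum_lt_sum (fun j _ => hcol j) ⟨j, mem_univ _, hlt⟩
    simp only [sum_const, card_univ, Fintype.card_fin, smul_eq_mul, mul_one] at h'
    omega
  -- the row of the unique variable in each column
  have hex : ∀ j, ∃ r, d (r, j) ≠ 0 := fun j => by
    by_contra h
    push Not at h
    have h0 : colCount d j = 0 := Finset.sum_eq_zero fun r _ => h r
    rw [hcol1] at h0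
    exact one_ne_zero h0
  choose g hg using hex
  have hg_inj : Function.Injective g := by
    intro j j' hjj'
    by_contra hne
    have h2 : d (g j, j) + d (g j, j') ≤ rowCount d (g j) := by
      unfold rowCount
      exact Finset.add_le_sum (f := fun c => d (g j, c)) (fun _ _ => Nat.zero_le _) (mem_univ _)
        (mem_univ _) hne
    have h1 : 1 ≤ d (g j, j) := Nat.one_le_iff_ne_zero.mpr (hg j)
    have h1' : 1 ≤ d (g j, j') := by
      rw [hjj']
      exact Nat.one_le_iff_ne_zero.mpr (hg j')
    have := hrow (g j)
    omega
  refine ⟨Equiv.ofBijective g (Finite.injective_iff_bijective.mp hg_inj), ?_⟩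
  ext ⟨r, c⟩
  rw [permMonomial_apply, Equiv.ofBijective_apply]
  have hle : d (g c, c) ≤ 1 :=
    (Finset.single_le_sum (f := fun r' => d (r', c)) (fun _ _ => Nat.zero_le _)
      (mem_univ (g c))).trans (hcol c)
  split_ifs with h
  · subst h
    have := hg c
    omega
  · by_contra hrc
    have h2 : d (g c, c) + d (r, c) ≤ colCount d c := by
      unfold colCount
      exact Finset.add_le_sum (f := fun r' => d (r', c)) (fun _ _ => Nat.zero_le _) (mem_univ _)
        (mem_univ _) h
    have h1 : 1 ≤ d (g c, c) := Nat.one_le_iff_ne_zero.mpr (hg c)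
    have := hcol c
    omega

/-! ### The anchor -/

/-- **PurePowerAnchor** (item `stmt-ValiantsHypothesis-11572`, route `ForgivenCollisions`):
`(Σ_{ij} x_{ij})^n − n! · per_n ∈ J_1(n)`, the ideal spanned by the monomials `x^d` with
`(∃ i, 3 ≤ rowCount d i) ∨ (∃ j, 3 ≤ colCount d j) ∨ 1 ≤ #{i | 2 ≤ rowCount d i} + #{j | 2 ≤ colCount d j}`.
The coefficient of a rook-legal degree-`n` monomial in `(Σ x)^n` is `n!` and it is a permutation
monomial; every collision is forgiven. [folklore] -/
theorem purePowerAnchor_proof :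
    Summit.ValiantsHypothesis.ValiantsHypothesis.Theses.ForgivenCollisions.PurePowerAnchor := by
  unfold Summit.ValiantsHypothesis.ValiantsHypothesis.Theses.ForgivenCollisions.PurePowerAnchor
  intro n
  rw [MvPolynomial.mem_ideal_span_monomial_image]
  intro d hd
  refine ⟨d, ?_, le_rfl⟩
  by_contra hbad
  have hrow : ∀ i, rowCount d i ≤ 1 := fun i => by
    by_contra h
    refine hbad (Or.inr (Or.inr ?_))
    have : 0 < (Finset.univ.filter fun i : Fin n => 2 ≤ rowCount d i).card :=
      Finset.card_pos.mpr ⟨i, Finset.mem_filter.mpr ⟨Finset.mem_univ _, by omega⟩⟩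
    omega
  have hcol : ∀ j, colCount d j ≤ 1 := fun j => by
    by_contra h
    refine hbad (Or.inr (Or.inr ?_))
    have : 0 < (Finset.univ.filter fun j : Fin n => 2 ≤ colCount d j).card :=
      Finset.card_pos.mpr ⟨j, Finset.mem_filter.mpr ⟨Finset.mem_univ _, by omega⟩⟩
    omega
  refine (mem_support_iff.mp hd) ?_
  rw [coeff_sub, coeff_smul, coeff_sum_X_pow, smul_eq_mul, sub_eq_zero]
  by_cases hdeg : ∑ v, d v = n
  · obtain ⟨σ, rfl⟩ := exists_permMonomial_eq_of_counts_le_one d hrow hcol hdeg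
    rw [if_pos hdeg, coeff_permMonomial_perPoly, mul_one, multinomial_permMonomial]
  · rw [if_neg hdeg]
    have h0 : coeff d (perPoly (Fin n) ℂ) = 0 := by
      by_contra hne
      obtain ⟨σ, rfl⟩ := exists_permMonomial_eq_of_coeff_perPoly_ne_zero ℂ hne
      exact hdeg (sum_permMonomial σ)
    rw [h0, mul_zero]

end Summit.ValiantsHypothesis.ValiantsHypothesis.Theorems.ForgivenCollisions
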